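import Mathlib
import Summits.PneNP.PneNP.Theorems.Nc03AvoidResidualCoreCandStarAffine

/-!
# Route Nc03AvoidResidualCore, crux `CandStarReduction` (X₂) — the tangled-surplus solver, IV: the dimension count and correctness

Helper file for `stmt-PneNP-19963` (sequel of `…CandStarAffine`; cell pnp-ideate, rung F-N1b). The rank
argument closing Algorithm ★ (disjoint-cherry variant): if EVERY flip set passed the span test, the column
span `𝒜` (dimension `≤ n − #FS`) would contain, for each covered output that is not a second cherry edge,
an explicit vector (`vfam`: its unit vector, plus the unit vector of the partner edge for a first cherry
edge); these are linearly independent (`vfam_linearIndependent`) and there are at least `#TS − #FS` of them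
— impossible once `#TS ≥ n + 1` (`exists_failing`). Hence the chosen flip set fails the test, its pattern
lies outside `𝒜`, and so outside the range (`mainOut_not_mem_range`); with the parallel kill (F1) and the
cover count: **`starOut_correct`** — for a pure-`CAND` instance with `2n+1 ≤ #tangled`, the solver's answer
is outside the range.

Restricted-model (NC⁰₃) range-avoidance rung F-N1b of the PneNP frontier ladder; no bearing on P vs NP.
-/

set_option linter.dupNamespace false -- `Summit.PneNP.PneNP.…`: summit = sub-problem name (D-0017 single-conjunct layout)

namespace Summit.PneNP.PneNP.Theorems.Nc03CandStar

open Finset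
open Literature.Computability.Complexity Nc03Reduction
open Summit.PneNP.PneNP.Theorems.Nc03AvoidResidualCoreCandFewHeadsRungFP (tri)
open Summit.PneNP.PneNP.Theorems.Nc03AvoidResidualCoreCandFewHeadsRung (pset not_mem_range_of_parallel)
open Summit.PneNP.PneNP.Theorems.Nc03AvoidResidualCoreCandCherry (tangled)

variable {N M : ℕ} (J : LocalMap 3 N M)

/-! ## The column span -/

/-- The span of the columns of the unforced variables. -/
noncomputable def Aspan : Submodule (ZMod 2) (Vec M) :=
  Submodule.span (ZMod 2) (Set.range fun v : ↥((FS J)ᶜ) => colVec J v)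

/-- The image form of the generating set is the range form. -/
theorem colVec_image_eq_range :
    colVec J '' {v | v ∉ FS J} = Set.range (fun v : ↥((FS J)ᶜ) => colVec J v) := by
  ext w
  simp only [Set.mem_image, Set.mem_setOf_eq, Set.mem_range, Subtype.exists, Finset.mem_compl]
  constructor
  · rintro ⟨v, hv, rfl⟩; exact ⟨v, hv, rfl⟩
  · rintro ⟨v, hv, rfl⟩; exact ⟨v, hv, rfl⟩

/-- Reading the span test against `Aspan`. -/
theorem test_iff' (S : List ℕ) :
    inSpan M (cols (rawOf J) (cher (rawOf J))) (tvec (rawOf J) (cher (rawOf J)) S) = true ↔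
      Wv J (yS J S) ∈ Aspan J := by
  rw [test_iff, Aspan, colVec_image_eq_range]

/-- `Aspan` has dimension at most the number of unforced variables. -/
theorem finrank_Aspan_le : Module.finrank (ZMod 2) (Aspan J) ≤ N - #(FS J) := by
  have h := finrank_range_le_card (R := ZMod 2) (fun v : ↥((FS J)ᶜ) => colVec J v)
  rw [Fintype.card_coe, Finset.card_compl, Fintype.card_fin] at h
  exact h

/-! ## Flipping -/

/-- The indicator of the covered outputs indexed by `S`. -/
def indTS (S : List ℕ) : Vec M := fun w => if w ∈ TS J ∧ w.val ∈ S then 1 else 0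

/-- The unit vector of a raw index. -/
def indN (M k : ℕ) : Vec M := fun w => if w.val = k then 1 else 0

/-- `𝔽₂` bookkeeping of a flip. -/
theorem ite_flip (s m b : Bool) : (if ((s ^^ m) ^^ b) = true then (1 : ZMod 2) else 0) =
    (if ((s ^^ false) ^^ b) = true then (1 : ZMod 2) else 0) + (if m = true then (1 : ZMod 2) else 0) := by
  revert s m b; decide

/-- **Flipping on `S` adds the indicator of `S ∩ TS`.** -/
theorem Wv_yS (S : List ℕ) : Wv J (yS J S) = Wv J (yS J []) + indTS J S := by
  funext w
  unfold Wv yS indTS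
  simp only [Pi.add_apply, List.not_mem_nil, decide_false]
  by_cases hw : w ∈ TS J
  · simp only [hw, true_and]
    rw [ite_flip]
    by_cases hm : w.val ∈ S <;> simp [hm]
  · simp [hw]

/-- The indicator of one covered output is its unit vector. -/
theorem indTS_single {o : Fin M} (ho : o ∈ TS J) : indTS J [o.val] = ind o := by
  funext w
  unfold indTS ind
  by_cases h : w = o
  · subst h; simp [ho]
  · have : w.val ≠ o.val := fun e => h (Fin.ext e)
    simp [h, this]

/-- The indicator of a chosen cherry is the sum of the unit vectors of its edges. -/
theorem indTS_cherry {q : ℕ × ℕ × ℕ} (hq : q ∈ cher (rawOf J)) (j : Fin M) (hj : j.val = q.2.1) :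
    indTS J [q.2.1, q.2.2] = ind j + indN M q.2.2 := by
  obtain ⟨j₁, j', u, hqe, hlt, -⟩ := cher_spec J hq
  have hq1 : q.2.1 = j₁.val := by rw [hqe]
  have hq2 : q.2.2 = j'.val := by rw [hqe]
  have hjj : j = j₁ := Fin.ext (hj.trans hq1)
  subst hjj
  have hT1 : j ∈ TS J := mem_TS_of_mem_CE J ((mem_CE_iff J).2 ⟨q, hq, Or.inl hq1⟩)
  have hT2 : j' ∈ TS J := mem_TS_of_mem_CE J ((mem_CE_iff J).2 ⟨q, hq, Or.inr hq2⟩)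
  have hne : j ≠ j' := ne_of_lt hlt
  funext w
  unfold indTS ind indN
  simp only [Pi.add_apply, List.mem_cons, List.not_mem_nil, or_false, hq1, hq2]
  by_cases h1 : w = j
  · subst h1
    have : w.val ≠ j'.val := fun e => hne (Fin.ext e)
    simp [hT1, this]
  · have h1' : w.val ≠ j.val := fun e => h1 (Fin.ext e)
    by_cases h2 : w = j'
    · subst h2; simp [hT2, h1, h1']
    · have h2' : w.val ≠ j'.val := fun e => h2 (Fin.ext e)
      simp [h1, h1', h2']

/-! ## Second edges and the independent family -/

/-- The second edge of the chosen cherry whose first edge is `o` (junk `0` otherwise). -/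
def snd2 (ch : List (ℕ × ℕ × ℕ)) (o : ℕ) : ℕ :=
  ((ch.find? fun q => decide (q.2.1 = o)).map fun q => q.2.2).getD 0

/-- `snd2` reads the chosen cherries. -/
theorem snd2_eq {q : ℕ × ℕ × ℕ} (hq : q ∈ cher (rawOf J)) : snd2 (cher (rawOf J)) q.2.1 = q.2.2 := by
  unfold snd2
  cases h : (cher (rawOf J)).find? (fun q' => decide (q'.2.1 = q.2.1)) with
  | none =>
    exfalso
    have := List.find?_eq_none.1 h q hq
    simp at this
  | some q' =>
    have hq' := List.mem_of_find?_eq_some h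
    have he : q'.2.1 = q.2.1 := by simpa using List.find?_some h
    have hqq : q' = q := by
      by_contra hne
      exact (clash_eq_false_iff.1 (cher_clash_false J hq' hq hne)).2.1 he
    rw [hqq]; rfl

/-- The second cherry edges among the outputs. -/
def S2 : Finset (Fin M) := univ.filter fun o => o.val ∈ (cher (rawOf J)).map fun q => q.2.2

/-- The covered outputs that are not second cherry edges. -/
def RS : Finset (Fin M) := (TS J).filter fun o => o.val ∉ (cher (rawOf J)).map fun q => q.2.2

/-- Membership in `S2`. -/
theorem mem_S2_iff {o : Fin M} : o ∈ S2 J ↔ ∃ q ∈ cher (rawOf J), q.2.2 = o.val := by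
  unfold S2; simp

/-- Membership in `RS`. -/
theorem mem_RS_iff {o : Fin M} : o ∈ RS J ↔ o ∈ TS J ∧ ∀ q ∈ cher (rawOf J), q.2.2 ≠ o.val := by
  unfold RS
  rw [Finset.mem_filter]
  refine and_congr Iff.rfl ?_
  rw [List.mem_map, not_exists]
  refine forall_congr' fun q => ?_
  rw [not_and]

/-- The family: unit vector of the output, plus the unit vector of the partner edge for a first edge. -/
def vfam (o : Fin M) : Vec M :=
  ind o + if sig (cher (rawOf J)) o.val = true then indN M (snd2 (cher (rawOf J)) o.val) else 0

/-- The partner coordinate of a first edge is a second edge, hence outside `RS`. -/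
theorem indN_snd2_apply_eq_zero {o w : Fin M} (ho : sig (cher (rawOf J)) o.val = true) (hw : w ∈ RS J) :
    indN M (snd2 (cher (rawOf J)) o.val) w = 0 := by
  obtain ⟨q, hq, hqo⟩ := (sig_iff _ _).1 ho
  rw [← hqo, snd2_eq J hq]
  unfold indN
  rw [if_neg]
  exact fun e => ((mem_RS_iff J).1 hw).2 q hq e.symm

/-- The family evaluated inside `RS`: the Kronecker delta. -/
theorem vfam_apply {o w : Fin M} (hw : w ∈ RS J) : vfam J o w = if w = o then 1 else 0 := by
  unfold vfam
  rw [Pi.add_apply]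
  unfold ind
  by_cases hs : sig (cher (rawOf J)) o.val = true
  · rw [if_pos hs, indN_snd2_apply_eq_zero J hs hw, add_zero]
  · rw [if_neg hs, Pi.zero_apply, add_zero]

/-- **The family is linearly independent on `RS`.** -/
theorem vfam_linearIndependent : LinearIndependent (ZMod 2) (fun o : ↥(RS J) => vfam J o) := by
  rw [Fintype.linearIndependent_iff]
  intro g hg i₀
  have h := congrFun hg (i₀ : Fin M)
  rw [Finset.sum_apply, Pi.zero_apply] at h
  rw [Finset.sum_eq_single i₀] at h
  · simpa [vfam_apply J i₀.2] using h
  · intro i _ hi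
    rw [Pi.smul_apply, vfam_apply J i₀.2, if_neg (fun e => hi (Subtype.ext e.symm)), smul_zero]
  · intro h0; exact absurd (Finset.mem_univ i₀) h0

/-- **Under the all-pass hypothesis, the family lies in the column span.** -/
theorem vfam_mem_Aspan (hall : ∀ S ∈ kers (rawOf J) (cher (rawOf J)), Wv J (yS J S) ∈ Aspan J)
    {o : Fin M} (ho : o ∈ RS J) : vfam J o ∈ Aspan J := by
  have h0 : Wv J (yS J []) ∈ Aspan J := hall [] (mem_kers_iff.2 (Or.inl rfl))
  obtain ⟨hoT, hns⟩ := (mem_RS_iff J).1 ho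
  have key : ∀ S ∈ kers (rawOf J) (cher (rawOf J)), indTS J S ∈ Aspan J := by
    intro S hS
    have h1 := hall S hS
    rw [Wv_yS] at h1
    have := Submodule.sub_mem _ h1 h0
    rwa [add_sub_cancel_left] at this
  unfold vfam
  by_cases hs : sig (cher (rawOf J)) o.val = true
  · rw [if_pos hs]
    obtain ⟨q, hq, hqo⟩ := (sig_iff _ _).1 hs
    rw [← hqo, snd2_eq J hq, ← indTS_cherry J hq o hqo.symm]
    exact key _ (mem_kers_iff.2 (Or.inr (Or.inr ⟨q, hq, rfl⟩)))
  · rw [if_neg hs, add_zero, ← indTS_single J hoT]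
    refine key _ (mem_kers_iff.2 (Or.inr (Or.inl ⟨o.val, (mem_covL_iff_TS J o).2 hoT, ?_, rfl⟩)))
    intro he
    obtain ⟨q, hq, h | h⟩ := (mem_edgeL_iff _ _).1 he
    · exact hs ((sig_iff _ _).2 ⟨q, hq, h⟩)
    · exact hns q hq h

/-! ## Counting -/

/-- Apexes of chosen cherries are variables. -/
theorem apex_lt {q : ℕ × ℕ × ℕ} (hq : q ∈ cher (rawOf J)) : q.1 < N := by
  obtain ⟨j, j', u, rfl, -⟩ := cher_spec J hq
  exact u.isLt

/-- The apex list is duplicate-free. -/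
theorem nodup_forcedL : (forcedL (cher (rawOf J))).Nodup := by
  unfold forcedL
  rw [List.Nodup, List.pairwise_map]
  exact (cher_pairwise J).imp fun h => (clash_eq_false_iff.1 h).1

/-- **`#FS` is the number of chosen cherries.** -/
theorem card_FS : #(FS J) = (cher (rawOf J)).length := by
  have hmap : (FS J).map Fin.valEmbedding = (forcedL (cher (rawOf J))).toFinset := by
    ext k
    rw [Finset.mem_map, List.mem_toFinset]
    constructor
    · rintro ⟨u, hu, rfl⟩
      obtain ⟨q, hq, hqu⟩ := (mem_FS_iff J).1 hu
      unfold forcedL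
      exact List.mem_map.2 ⟨q, hq, hqu⟩
    · intro hk
      obtain ⟨q, hq, rfl⟩ := List.mem_map.1 hk
      exact ⟨⟨q.1, apex_lt J hq⟩, (mem_FS_iff J).2 ⟨q, hq, rfl⟩, rfl⟩
  rw [← Finset.card_map Fin.valEmbedding, hmap, List.toFinset_card_of_nodup (nodup_forcedL J)]
  unfold forcedL; rw [List.length_map]

/-- The second edges are at most as many as the cherries. -/
theorem card_S2_le : #(S2 J) ≤ (cher (rawOf J)).length := by
  have hsub : (S2 J).map Fin.valEmbedding ⊆ ((cher (rawOf J)).map fun q => q.2.2).toFinset := by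
    intro k hk
    obtain ⟨o, ho, rfl⟩ := Finset.mem_map.1 hk
    rw [List.mem_toFinset]
    exact (Finset.mem_filter.1 ho).2
  calc #(S2 J) = #((S2 J).map Fin.valEmbedding) := (Finset.card_map _).symm
    _ ≤ #(((cher (rawOf J)).map fun q => q.2.2).toFinset) := Finset.card_le_card hsub
    _ ≤ ((cher (rawOf J)).map fun q => q.2.2).length := List.toFinset_card_le _
    _ = (cher (rawOf J)).length := List.length_map _

/-- `#TS ≤ #RS + #S2`. -/
theorem card_TS_le : #(TS J) ≤ #(RS J) + #(S2 J) := by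
  have h : TS J ⊆ RS J ∪ S2 J := by
    intro o ho
    rw [Finset.mem_union]
    by_cases h2 : o.val ∈ (cher (rawOf J)).map fun q => q.2.2
    · exact Or.inr (Finset.mem_filter.2 ⟨Finset.mem_univ _, h2⟩)
    · exact Or.inl (Finset.mem_filter.2 ⟨ho, h2⟩)
  exact (Finset.card_le_card h).trans (Finset.card_union_le _ _)

/-- **Some flip set fails the span test** once `#TS ≥ n + 1`. -/
theorem exists_failing (hT : N + 1 ≤ #(TS J)) :
    ∃ S ∈ kers (rawOf J) (cher (rawOf J)),
      inSpan M (cols (rawOf J) (cher (rawOf J))) (tvec (rawOf J) (cher (rawOf J)) S) = false := by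
  by_contra hno
  push Not at hno
  have hall : ∀ S ∈ kers (rawOf J) (cher (rawOf J)), Wv J (yS J S) ∈ Aspan J := fun S hS =>
    (test_iff' J S).1 (by simpa using hno S hS)
  have hli := vfam_linearIndependent J
  have h1 : Fintype.card ↥(RS J) = Module.finrank (ZMod 2)
      (Submodule.span (ZMod 2) (Set.range fun o : ↥(RS J) => vfam J o)) := (finrank_span_eq_card hli).symm
  have h2 : Submodule.span (ZMod 2) (Set.range fun o : ↥(RS J) => vfam J o) ≤ Aspan J :=
    Submodule.span_le.2 (Set.range_subset_iff.2 fun o => vfam_mem_Aspan J hall o.2)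
  have h3 := Submodule.finrank_mono h2
  have h4 := finrank_Aspan_le J
  rw [Fintype.card_coe] at h1
  have h5 := card_TS_le J
  have h6 := card_S2_le J
  have h7 := card_FS J
  have h8 : #(FS J) ≤ N := by simpa using Finset.card_le_univ (FS J)
  omega

/-! ## Correctness -/

/-- **Correctness of the main branch**: with no parallel pair and `#TS ≥ n + 1`, the main answer is outside
the range. -/
theorem mainOut_not_mem_range (hI : J.IsPure candPred) (hT : N + 1 ≤ #(TS J)) :
    (fun o : Fin M => (mainOut (rawOf J)).getD o.val false) ∉ J.range := by
  rw [mainOut_read]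
  -- the chosen flip set fails the span test
  obtain ⟨S₁, hS₁, hfail⟩ := exists_failing J hT
  set P := pick (rawOf J) (cher (rawOf J)) with hP
  have hPfail : inSpan M (cols (rawOf J) (cher (rawOf J))) (tvec (rawOf J) (cher (rawOf J)) P) = false := by
    rw [hP]
    unfold pick
    cases h : (kers (rawOf J) (cher (rawOf J))).find?
        (fun S => !inSpan (rawOf J).2.1 (cols (rawOf J) (cher (rawOf J))) (tvec (rawOf J) (cher (rawOf J)) S)) with
    | none =>
      exfalso
      have := List.find?_eq_none.1 h S₁ hS₁
      rw [rawOf_M, hfail] at this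
      simp at this
    | some S =>
      have := List.find?_some h
      rw [rawOf_M] at this
      simpa using this
  -- a preimage would force the apexes and put the pattern in the column span
  rintro ⟨x, hx⟩
  have hforce := forced_of_eval J hI (goodFlip_of_mem_kers J (pick_mem_kers _ _)) hx
  have hmem : Wv J (yS J P) ∈ Aspan J := by
    rw [hP, ← hx, Aspan, ← colVec_image_eq_range]
    exact Wv_eval_mem_span J hI hforce
  rw [← test_iff'] at hmem
  rw [hmem] at hPfail
  exact Bool.noConfusion hPfail

/-- **Correctness of the tangled-surplus solver.** For a pure-`CAND` instance with at least `2n+1` tangled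
outputs, the answer `starOut (rawOf J)` (read as a pattern) lies outside the range. -/
theorem starOut_correct (hI : J.IsPure candPred) (hL : 2 * N + 1 ≤ #(tangled J)) :
    (fun o : Fin M => (starOut (rawOf J)).getD o.val false) ∉ J.range := by
  unfold starOut starDispatch
  cases h : findPar (rawOf J) with
  | some p =>
    obtain ⟨j, j', rfl, hne, hh, hps⟩ := findPar_eq_some J h
    simp only [rawOf_M]
    refine not_mem_range_of_parallel hI hh hps (y := fun o : Fin M => (indic M [j.val]).getD o.val false) ?_ ?_
    · show (indic M [j.val]).getD j.val false = true
      rw [indic_at]; simp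
    · show (indic M [j.val]).getD j'.val false = false
      rw [indic_at]
      have : j'.val ≠ j.val := fun e => hne (Fin.ext e).symm
      simp [this]
  | none =>
    simp only
    exact mainOut_not_mem_range J hI (succ_le_card_TS J hI h hL)

end Summit.PneNP.PneNP.Theorems.Nc03CandStar
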